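import Summits.Ventures.HSemireg.WedgeHankelOuterCount
import Summits.Ventures.HSemireg.WedgeHankelOuterFamilyImage

/-!
# Venture HSemireg — THE COMPLETE TABLE OF PIECES FOR A FAMILY OF CLASSES: for every finite family `(w_N(q_c))_c`, all disjoint `A₁`, `A₂` and `k = |A₁| + 2|A₂|`,
# **`dim (Hom(univ,k) ⊓ ⋂_c Kr(univ, w_N q_c, k) ⊓ Sp(ptype = 𝟙_{A₁} + 2·𝟙_{A₂})) + [A₂ = ∅] · rank [H_k(q_c)]_c = 2^{|A₁|}`** (JOINT KERNEL) and
# **`dim (JR_k((w_N q_c)_c) ⊓ Π_c Sp(ptype = 𝟙_{A₁} + 2·𝟙_{A₂} + 𝟙)) = [A₂ = ∅] · rank [H_k(q_c)]_c`** (JOINT RANGE) — L5's table for one class, verbatim for families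

HONEST FRAMING. Part of the Lean index of the computation cell `pub-hsemireg` (seat p10 gen 24, Sunday typer «UNIFORM-IN-n»).
Finite-dimensional EXTERIOR ALGEBRA over a field ONLY: no variety, no cohomology theory, no sheaf, no Ext group, no semiregularity map;
nothing here says that HC / HC_CM / HC_AV holds; no Literature fact is declared or used.  Custodian versions as in `WedgeHankelSiegelIdeal` (1/3); the dictionary (pair type = the
multidegree of a Künneth piece; `JR` = the joint image of `θ ↦ (θ ∧ w_N(q_c))_c`) is QUOTED, never asserted.

WHAT IS IN THE TREE.  L5 (`WedgeHankelOuterCount`): `ptype_eq_one_two` (every pair type is `𝟙_{A₁} + 2·𝟙_{A₂}`), `card_filter_ptype_eq_one_two`, `finrank_Sp_ptype_one_two` (`= 2^{|A₁|}`),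
`Hom_inf_Sp_ptype_one_two`, and the one-class table `finrank_Kr_w_inf_Sp_ptype_one_two_add` / `finrank_V_w_inf_Sp_ptype_one_two_succ`; M2 = this seat's `WedgeHankelOuterFamilyImage`:
`Hom_iInf_Kr_inf_Sp_ptype_eq_Hom_inf_of_two_le`, `finrank_JR_inf_pi_Sp_ptype_succ_eq_zero_of_two_le`, `finrank_JR_w_inf_pi_Sp_pure_succ`; J2 (`WedgeHankelOuterFamilyPure`):
`finrank_iInf_Kr_w_inf_Sp_pure_add`; L4: `Hom_inf_Sp_pure`.
THIS FILE (namespace `Summit.Ventures.HSemireg.Wedge.HankelOuter` continued; imports L5 and M2):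
* §403 `A₂ ≠ ∅`: **`finrank_Hom_iInf_Kr_w_inf_Sp_ptype_one_two_of_nonempty`** (the whole piece is joint kernel, `2^{|A₁|}`) and **`finrank_JR_w_inf_pi_Sp_ptype_one_two_succ_of_nonempty`**
  (no joint image); the uniform statements **`finrank_Hom_iInf_Kr_w_inf_Sp_ptype_one_two_add`** (THE JOINT KERNEL TABLE) and **`finrank_JR_w_inf_pi_Sp_ptype_one_two_succ`** (THE JOINT
  RANGE TABLE), for every finite family, all disjoint `A₁`, `A₂`, every field; `finrank_Hom_iInf_Kr_w_inf_Sp_ptype_add_finrank_JR` (the two tables add up to `2^{|A₁|}` piece by piece).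
READING: with H10/I7 (a kernel / an image is the direct sum of its pair-type pieces) this is the value of EVERY piece of the joint kernel and of the joint range of a family: the block
Hankel rank `rank [H_k(q_c)]_c` is seen once by every `k`-set of pairs, through its multilinear piece, and by nothing else — J1's joint kernel law `C(2N,k) − C(N,k)·rank [H_k(q_c)]_c`
term by term.  Nothing Ext-side.  New names only.
-/

open Module

namespace Summit.Ventures.HSemireg.Wedge.HankelOuter

open Summit.Ventures.HSemireg.Wedge Summit.Ventures.HSemireg.Wedge.Kunneth Summit.Ventures.HSemireg.Wedge.Hankel
  Summit.Ventures.HSemireg.Wedge.BasisFree Summit.Ventures.HSemireg.Wedge.HankelSiegel Summit.Ventures.HSemireg.Wedge.HankelSiegelIdeal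
  Summit.Ventures.HSemireg.Wedge.KunnethKernel Summit.Ventures.HSemireg.Wedge.HankelFrameChange Summit.Ventures.HSemireg.Wedge.Weil
  Summit.Ventures.HSemireg.Wedge.HankelPairMixing Summit.Ventures.HSemireg.Wedge.HankelPairGrading

variable (K : Type*) [Field K] {N : ℕ} {ι : Type} [Fintype ι] [DecidableEq ι]

/-! ## §403. The complete table of pieces for a family of classes -/

omit [Fintype ι] [DecidableEq ι] in
/-- **`A₂ ≠ ∅`: THE WHOLE PIECE IS JOINT KERNEL, `dim (Hom(univ,k) ⊓ ⋂_c Kr(univ, w_N q_c, k) ⊓ Sp(ptype = 𝟙_{A₁} + 2·𝟙_{A₂})) = 2^{|A₁|}`**, `k = |A₁| + 2|A₂|` (every finite family). -/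
theorem finrank_Hom_iInf_Kr_w_inf_Sp_ptype_one_two_of_nonempty {A₁ A₂ : Finset (Fin N)} (hd : Disjoint A₁ A₂) (hne : A₂.Nonempty) (q : ι → ℕ → K) :
    finrank K ↥(Hom K (In N) (Finset.univ : Finset (In N)) (A₁.card + (A₂.card + A₂.card))
        ⊓ (⨅ c, Kr K (Finset.univ : Finset (In N)) (w K N N (q c)) (A₁.card + (A₂.card + A₂.card)))
        ⊓ Sp K (fun s : Finset (In N) => ptype s = fun c => if c ∈ A₁ then 1 else if c ∈ A₂ then 2 else 0)) = 2 ^ A₁.card := by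
  obtain ⟨c, hc⟩ := hne
  have h2 : 2 ≤ (fun c : Fin N => if c ∈ A₁ then 1 else if c ∈ A₂ then 2 else 0) c := by
    dsimp only
    rw [if_neg (fun h1 => Finset.disjoint_left.mp hd h1 hc), if_pos hc]
  rw [Hom_iInf_Kr_inf_Sp_ptype_eq_Hom_inf_of_two_le K h2 (fun c => w_mem_Sp_Tr K (q c)), Hom_inf_Sp_ptype_one_two K hd, finrank_Sp_ptype_one_two K hd]

omit [Fintype ι] [DecidableEq ι] in
/-- **`A₂ ≠ ∅`: NO JOINT IMAGE, `dim (JR_k((w_N q_c)_c) ⊓ Π_c Sp(ptype = 𝟙_{A₁} + 2·𝟙_{A₂} + 𝟙)) = 0`**, `k = |A₁| + 2|A₂|` (every finite family). -/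
theorem finrank_JR_w_inf_pi_Sp_ptype_one_two_succ_of_nonempty {A₁ A₂ : Finset (Fin N)} (hd : Disjoint A₁ A₂) (hne : A₂.Nonempty) (q : ι → ℕ → K) :
    finrank K ↥(JR K (In N) (Finset.univ : Finset (In N)) (A₁.card + (A₂.card + A₂.card)) (fun c => w K N N (q c))
        ⊓ Submodule.pi (Set.univ : Set ι) (fun _ => Sp K (fun s : Finset (In N) => ptype s = (fun c => if c ∈ A₁ then 1 else if c ∈ A₂ then 2 else 0) + 1))) = 0 := by
  obtain ⟨c, hc⟩ := hne
  have h2 : 2 ≤ (fun c : Fin N => if c ∈ A₁ then 1 else if c ∈ A₂ then 2 else 0) c := by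
    dsimp only
    rw [if_neg (fun h1 => Finset.disjoint_left.mp hd h1 hc), if_pos hc]
  exact finrank_JR_inf_pi_Sp_ptype_succ_eq_zero_of_two_le K h2 (fun c => w_mem_Sp_Tr K (q c)) _

/-- **THE JOINT KERNEL TABLE: `dim (Hom(univ,k) ⊓ ⋂_c Kr(univ, w_N q_c, k) ⊓ Sp(ptype = 𝟙_{A₁} + 2·𝟙_{A₂})) + [A₂ = ∅] · rank (hank K N k q) = 2^{|A₁|}`**, `k = |A₁| + 2|A₂|`,
for every finite family `q`, all disjoint `A₁`, `A₂`, every field. -/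
theorem finrank_Hom_iInf_Kr_w_inf_Sp_ptype_one_two_add {A₁ A₂ : Finset (Fin N)} (hd : Disjoint A₁ A₂) (q : ι → ℕ → K) :
    finrank K ↥(Hom K (In N) (Finset.univ : Finset (In N)) (A₁.card + (A₂.card + A₂.card))
        ⊓ (⨅ c, Kr K (Finset.univ : Finset (In N)) (w K N N (q c)) (A₁.card + (A₂.card + A₂.card)))
        ⊓ Sp K (fun s : Finset (In N) => ptype s = fun c => if c ∈ A₁ then 1 else if c ∈ A₂ then 2 else 0))
      + (if A₂ = ∅ then 1 else 0) * (hank K N (A₁.card + (A₂.card + A₂.card)) (fun (_ : Unit) (c : ι) => q c)).rank = 2 ^ A₁.card := by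
  by_cases hA : A₂ = ∅
  · subst hA
    rw [if_pos rfl, one_mul]
    have hSp : Sp K (fun s : Finset (In N) => ptype s = fun c => if c ∈ A₁ then 1 else if c ∈ (∅ : Finset (Fin N)) then 2 else 0)
        = Sp K (fun s : Finset (In N) => ptype s = fun c => if c ∈ A₁ then 1 else 0) :=
      Sp_congr_iff K fun s => by simp only [Finset.notMem_empty, if_false]
    rw [hSp, Finset.card_empty, add_zero, add_zero]
    exact finrank_iInf_Kr_w_inf_Sp_pure_add K A₁ q
  · rw [if_neg hA, zero_mul, add_zero]
    exact finrank_Hom_iInf_Kr_w_inf_Sp_ptype_one_two_of_nonempty K hd (Finset.nonempty_iff_ne_empty.mpr hA) q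

/-- **THE JOINT RANGE TABLE: `dim (JR_k((w_N q_c)_c) ⊓ Π_c Sp(ptype = 𝟙_{A₁} + 2·𝟙_{A₂} + 𝟙)) = [A₂ = ∅] · rank (hank K N k q)`**, `k = |A₁| + 2|A₂|`, for every finite family `q`,
all disjoint `A₁`, `A₂`, every field. -/
theorem finrank_JR_w_inf_pi_Sp_ptype_one_two_succ {A₁ A₂ : Finset (Fin N)} (hd : Disjoint A₁ A₂) (q : ι → ℕ → K) :
    finrank K ↥(JR K (In N) (Finset.univ : Finset (In N)) (A₁.card + (A₂.card + A₂.card)) (fun c => w K N N (q c))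
        ⊓ Submodule.pi (Set.univ : Set ι) (fun _ => Sp K (fun s : Finset (In N) => ptype s = (fun c => if c ∈ A₁ then 1 else if c ∈ A₂ then 2 else 0) + 1)))
      = (if A₂ = ∅ then 1 else 0) * (hank K N (A₁.card + (A₂.card + A₂.card)) (fun (_ : Unit) (c : ι) => q c)).rank := by
  by_cases hA : A₂ = ∅
  · subst hA
    rw [if_pos rfl, one_mul]
    have hSp : Submodule.pi (Set.univ : Set ι)
          (fun _ => Sp K (fun s : Finset (In N) => ptype s = (fun c => if c ∈ A₁ then 1 else if c ∈ (∅ : Finset (Fin N)) then 2 else 0) + 1))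
        = Submodule.pi (Set.univ : Set ι) (fun _ => Sp K (fun s : Finset (In N) => ptype s = (fun c => if c ∈ A₁ then 1 else 0) + 1)) := by
      simp only [Finset.notMem_empty, if_false]
    rw [hSp, Finset.card_empty, add_zero, add_zero]
    exact finrank_JR_w_inf_pi_Sp_pure_succ K A₁ q
  · rw [if_neg hA, zero_mul]
    exact finrank_JR_w_inf_pi_Sp_ptype_one_two_succ_of_nonempty K hd (Finset.nonempty_iff_ne_empty.mpr hA) q

omit [Fintype ι] [DecidableEq ι] in
/-- the two tables add up piece by piece: **`dim (Hom(univ,k) ⊓ ⋂_c Kr(univ, w_N q_c, k) ⊓ Sp(ptype = τ)) + dim (JR_k((w_N q_c)_c) ⊓ Π_c Sp(ptype = τ + 𝟙)) = 2^{|A₁|}`**,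
`τ = 𝟙_{A₁} + 2·𝟙_{A₂}`, `k = |A₁| + 2|A₂|` (rank–nullity on the piece, whose dimension is the count `2^{|A₁|}` of L5). -/
theorem finrank_Hom_iInf_Kr_w_inf_Sp_ptype_add_finrank_JR {A₁ A₂ : Finset (Fin N)} (hd : Disjoint A₁ A₂) (q : ι → ℕ → K) :
    finrank K ↥(Hom K (In N) (Finset.univ : Finset (In N)) (A₁.card + (A₂.card + A₂.card))
        ⊓ (⨅ c, Kr K (Finset.univ : Finset (In N)) (w K N N (q c)) (A₁.card + (A₂.card + A₂.card)))
        ⊓ Sp K (fun s : Finset (In N) => ptype s = fun c => if c ∈ A₁ then 1 else if c ∈ A₂ then 2 else 0))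
      + finrank K ↥(JR K (In N) (Finset.univ : Finset (In N)) (A₁.card + (A₂.card + A₂.card)) (fun c => w K N N (q c))
        ⊓ Submodule.pi (Set.univ : Set ι) (fun _ => Sp K (fun s : Finset (In N) => ptype s = (fun c => if c ∈ A₁ then 1 else if c ∈ A₂ then 2 else 0) + 1)))
      = 2 ^ A₁.card := by
  have h := finrank_JR_inf_pi_Sp_ptype_succ_add K (fun c => if c ∈ A₁ then 1 else if c ∈ A₂ then 2 else 0) (f := fun c => w K N N (q c))
    (fun c => w_mem_Sp_Tr K (q c)) (A₁.card + (A₂.card + A₂.card))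
  rw [Hom_inf_Sp_ptype_one_two K hd, finrank_Sp_ptype_one_two K hd] at h
  omega

end Summit.Ventures.HSemireg.Wedge.HankelOuter
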